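import Summits.SmoothPoincare4.SmoothPoincare4.Theses.EinsteinBulk
import Literature.Geometry.Riemannian.SimpleAHBoundarySphereProofs

/-!
# Birth skeleton of the piece `CompactificationConvexNearInfinity` (split child of crux
# `EinsteinBulk.EinsteinHadamardFillingStandard`, item stmt-SmoothPoincare4-7999)

Two stubs and the kernel-checked composition, mirroring the landed smooth-case proof
`SimpleAH.exists_convexity_threshold` (AHConvexNearInfinity.lean) = local estimate at each boundary
point (`SimpleAH.convexity_near_point`) + a compactness patching:

* `stub_convexity_near_point_C2` — THE ANALYTIC HALF: the local convexity estimate near a boundary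
  point `z` with `ḡ`-unit normal `ν`, for a `C²` compactified metric `ḡ` (the landed chart
  estimate `SimpleAH.deriv_deriv_comp_geodesic_neg` with the uniform constants of
  `SimpleAH.exists_chart_constants`, which need the chart metric only `C¹`).
* `stub_threshold_of_local` — THE TOPOLOGICAL HALF: patching local thresholds on open sets
  covering the compact zero set of `ρ` into one threshold `ε₀` on the collar `{ρ < ε₀}` (finite
  subcover, `SimpleAH.exists_sublevel_subset`).
* `CompactificationConvexNearInfinity_of` — the piece from the two stubs (real proof: the unit
  normals at boundary points feed stub 1, the boundary `= ρ⁻¹(0)` is compact, stub 2 patches).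
-/

noncomputable section

set_option linter.dupNamespace false

open Bundle Set Filter Function Metric TopologicalSpace
open scoped Manifold ContDiff Topology ContinuousMap

namespace Summit.SmoothPoincare4.SmoothPoincare4.Cruxes.EinsteinHadamardFillingStandard.GgsuC2Redirect

open Literature.Geometry.Lorentzian Literature.Geometry.Lorentzian.PseudoRiemannianMetric
  Literature.Geometry.Riemannian Literature.Geometry.Riemannian.SimpleAH

/-- The piece (verbatim the would-be route decl `EinsteinBulk.CompactificationConvexNearInfinity`). -/
def CompactificationConvexNearInfinity : Prop :=
  ∀ (N : Type) [TopologicalSpace N] [T2Space N] [SecondCountableTopology N] [ChartedSpace (EuclideanSpace ℝ (Fin 5)) N] [IsManifold (𝓡 5) ∞ N] (g : Bundle.ContMDiffRiemannianMetric (𝓡 5) ∞ (EuclideanSpace ℝ (Fin 5)) (TangentSpace (𝓡 5) : N → Type _)) [(Literature.Geometry.Lorentzian.PseudoRiemannianMetric.ofRiemannian g).HasLeviCivita] (X : Type) [TopologicalSpace X] [T2Space X] [SecondCountableTopology X] [ChartedSpace (EuclideanHalfSpace 5) X] [IsManifold (𝓡∂ 5) ∞ X] [CompactSpace X] (j : N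 → X) (ρ : X → ℝ) (gb : Bundle.ContMDiffRiemannianMetric (𝓡∂ 5) 2 (EuclideanSpace ℝ (Fin 5)) (TangentSpace (𝓡∂ 5) : X → Type _)), Manifold.IsSmoothEmbedding (𝓡 5) (𝓡∂ 5) ∞ j → Set.range j = (𝓡∂ 5).interior X → ContMDiff (𝓡∂ 5) 𝓘(ℝ, ℝ) ∞ ρ → (∀ x : X, 0 ≤ ρ x) → (∀ x : X, ρ x = 0 ↔ x ∈ (𝓡∂ 5).boundary X) → (∀ z : X, z ∈ (𝓡∂ 5).boundary X → ∃ ν : TangentSpace (𝓡∂ 5) z, gb.inner z ν ν = 1 ∧ ∀ v : TangentSpace (𝓡∂ 5) z, gb.inner z ν v = mfderiv (𝓡∂ 5) 𝓘(ℝ, ℝ) ρ z v) → (∀ (x : N) (v w : TangentSpace (𝓡 5) x), gb.inner (j x) (mfderiv (𝓡 5) (𝓡∂ 5) j x v) (mfderiv (𝓡 5) (𝓡∂ 5) j x w) = ρ (j x) ^ 2 * g.inner x v w) → ∃ ε₀ : ℝ, 0 < ε₀ ∧ ∀ γ : ℝ → N, Literature.Geometry.Lorentzian.IsGeodesic (Literature.Geometry.Lorentzian.PseudoRiemannianMetric.ofRiemannian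 g).leviCivita γ → ∀ t₀ : ℝ, g.inner (γ t₀) (Literature.Geometry.Lorentzian.velocity (𝓡 5) γ t₀) (Literature.Geometry.Lorentzian.velocity (𝓡 5) γ t₀) = 1 → ρ (j (γ t₀)) < ε₀ → deriv (fun t ↦ ρ (j (γ t))) t₀ = 0 → deriv (deriv fun t ↦ ρ (j (γ t))) t₀ < 0

/-- Stub 1 (analytic half): local convexity of the levels of `ρ ∘ j` near a boundary point, for a
`C²` compactified metric. [cite: GrahamEtAl2020, p. 10] -/
theorem stub_convexity_near_point_C2
    (N : Type) [TopologicalSpace N] [T2Space N] [SecondCountableTopology N]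
    [ChartedSpace (EuclideanSpace ℝ (Fin 5)) N] [IsManifold (𝓡 5) ∞ N]
    (g : Bundle.ContMDiffRiemannianMetric (𝓡 5) ∞ (EuclideanSpace ℝ (Fin 5))
      (TangentSpace (𝓡 5) : N → Type _))
    [(PseudoRiemannianMetric.ofRiemannian g).HasLeviCivita]
    (X : Type) [TopologicalSpace X] [T2Space X] [SecondCountableTopology X]
    [ChartedSpace (EuclideanHalfSpace 5) X] [IsManifold (𝓡∂ 5) ∞ X] [CompactSpace X]
    (j : N → X) (ρ : X → ℝ)
    (gb : Bundle.ContMDiffRiemannianMetric (𝓡∂ 5) 2 (EuclideanSpace ℝ (Fin 5))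
      (TangentSpace (𝓡∂ 5) : X → Type _))
    (hj : Manifold.IsSmoothEmbedding (𝓡 5) (𝓡∂ 5) ∞ j) (hjr : Set.range j = (𝓡∂ 5).interior X)
    (hρ : ContMDiff (𝓡∂ 5) 𝓘(ℝ, ℝ) ∞ ρ) (hρ0 : ∀ x : X, 0 ≤ ρ x)
    (hρb : ∀ x : X, ρ x = 0 ↔ x ∈ (𝓡∂ 5).boundary X)
    (hconf : ∀ (x : N) (v w : TangentSpace (𝓡 5) x),
      gb.inner (j x) (mfderiv (𝓡 5) (𝓡∂ 5) j x v) (mfderiv (𝓡 5) (𝓡∂ 5) j x w) =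
        ρ (j x) ^ 2 * g.inner x v w)
    (z : X) (ν : TangentSpace (𝓡∂ 5) z) (hν1 : gb.inner z ν ν = 1)
    (hν2 : ∀ a : TangentSpace (𝓡∂ 5) z, gb.inner z ν a = mfderiv (𝓡∂ 5) 𝓘(ℝ, ℝ) ρ z a) :
    ∃ V : Set X, IsOpen V ∧ z ∈ V ∧ ∃ κ : ℝ, 0 < κ ∧
      ∀ γ : ℝ → N, IsGeodesic (PseudoRiemannianMetric.ofRiemannian g).leviCivita γ →
        ∀ t₀ : ℝ, j (γ t₀) ∈ V →
          g.inner (γ t₀) (velocity (𝓡 5) γ t₀) (velocity (𝓡 5) γ t₀) = 1 →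
          ρ (j (γ t₀)) < κ → deriv (fun t ↦ ρ (j (γ t))) t₀ = 0 →
          deriv (deriv fun t ↦ ρ (j (γ t))) t₀ < 0 := by
  sorry

/-- Stub 2 (topological half): patching local thresholds near the compact zero set of a
nonnegative continuous `ρ` on a compact space into a global threshold on `{ρ < ε₀}`. [folklore] -/
theorem stub_threshold_of_local
    {N X : Type} [TopologicalSpace X] [CompactSpace X] (j : N → X) (ρ : X → ℝ)
    (hρc : Continuous ρ) (hρ0 : ∀ x : X, 0 ≤ ρ x) {B : Set X} (hBc : IsCompact B)
    (hρB : ∀ x : X, ρ x = 0 → x ∈ B)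
    {ι : Type} (pt : ι → N) (Q : ι → Prop)
    (hloc : ∀ z ∈ B, ∃ V : Set X, IsOpen V ∧ z ∈ V ∧ ∃ κ : ℝ, 0 < κ ∧
      ∀ i : ι, j (pt i) ∈ V → ρ (j (pt i)) < κ → Q i) :
    ∃ ε₀ : ℝ, 0 < ε₀ ∧ ∀ i : ι, ρ (j (pt i)) < ε₀ → Q i := by
  sorry

/-- **The piece from the two stubs.** [cite: GrahamEtAl2020, p. 10] -/
theorem CompactificationConvexNearInfinity_of
    (h₁ : ∀ (N : Type) [TopologicalSpace N] [T2Space N] [SecondCountableTopology N]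
      [ChartedSpace (EuclideanSpace ℝ (Fin 5)) N] [IsManifold (𝓡 5) ∞ N]
      (g : Bundle.ContMDiffRiemannianMetric (𝓡 5) ∞ (EuclideanSpace ℝ (Fin 5))
        (TangentSpace (𝓡 5) : N → Type _))
      [(PseudoRiemannianMetric.ofRiemannian g).HasLeviCivita]
      (X : Type) [TopologicalSpace X] [T2Space X] [SecondCountableTopology X]
      [ChartedSpace (EuclideanHalfSpace 5) X] [IsManifold (𝓡∂ 5) ∞ X] [CompactSpace X]
      (j : N → X) (ρ : X → ℝ)
      (gb : Bundle.ContMDiffRiemannianMetric (𝓡∂ 5) 2 (EuclideanSpace ℝ (Fin 5))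
        (TangentSpace (𝓡∂ 5) : X → Type _)),
      Manifold.IsSmoothEmbedding (𝓡 5) (𝓡∂ 5) ∞ j → Set.range j = (𝓡∂ 5).interior X →
      ContMDiff (𝓡∂ 5) 𝓘(ℝ, ℝ) ∞ ρ → (∀ x : X, 0 ≤ ρ x) →
      (∀ x : X, ρ x = 0 ↔ x ∈ (𝓡∂ 5).boundary X) →
      (∀ (x : N) (v w : TangentSpace (𝓡 5) x),
        gb.inner (j x) (mfderiv (𝓡 5) (𝓡∂ 5) j x v) (mfderiv (𝓡 5) (𝓡∂ 5) j x w) =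
          ρ (j x) ^ 2 * g.inner x v w) →
      ∀ (z : X) (ν : TangentSpace (𝓡∂ 5) z), gb.inner z ν ν = 1 →
        (∀ a : TangentSpace (𝓡∂ 5) z, gb.inner z ν a = mfderiv (𝓡∂ 5) 𝓘(ℝ, ℝ) ρ z a) →
        ∃ V : Set X, IsOpen V ∧ z ∈ V ∧ ∃ κ : ℝ, 0 < κ ∧
          ∀ γ : ℝ → N, IsGeodesic (PseudoRiemannianMetric.ofRiemannian g).leviCivita γ →
            ∀ t₀ : ℝ, j (γ t₀) ∈ V →
              g.inner (γ t₀) (velocity (𝓡 5) γ t₀) (velocity (𝓡 5) γ t₀) = 1 →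
              ρ (j (γ t₀)) < κ → deriv (fun t ↦ ρ (j (γ t))) t₀ = 0 →
              deriv (deriv fun t ↦ ρ (j (γ t))) t₀ < 0)
    (h₂ : ∀ {N X : Type} [TopologicalSpace X] [CompactSpace X] (j : N → X) (ρ : X → ℝ),
      Continuous ρ → (∀ x : X, 0 ≤ ρ x) → ∀ {B : Set X}, IsCompact B →
      (∀ x : X, ρ x = 0 → x ∈ B) →
      ∀ {ι : Type} (pt : ι → N) (Q : ι → Prop),
      (∀ z ∈ B, ∃ V : Set X, IsOpen V ∧ z ∈ V ∧ ∃ κ : ℝ, 0 < κ ∧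
        ∀ i : ι, j (pt i) ∈ V → ρ (j (pt i)) < κ → Q i) →
      ∃ ε₀ : ℝ, 0 < ε₀ ∧ ∀ i : ι, ρ (j (pt i)) < ε₀ → Q i) :
    CompactificationConvexNearInfinity := by
  intro N _ _ _ _ _ g _ X _ _ _ _ _ _ j ρ gb hj hjr hρs hρ0 hρb hν hconf
  -- the index type of stub 2: geodesics with a marked tangency parameter of unit speed
  let ι : Type := {p : (ℝ → N) × ℝ //
    IsGeodesic (PseudoRiemannianMetric.ofRiemannian g).leviCivita p.1 ∧
    g.inner (p.1 p.2) (velocity (𝓡 5) p.1 p.2) (velocity (𝓡 5) p.1 p.2) = 1 ∧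
    deriv (fun t ↦ ρ (j (p.1 t))) p.2 = 0}
  let pt : ι → N := fun i ↦ i.1.1 i.1.2
  let Q : ι → Prop := fun i ↦ deriv (deriv fun t ↦ ρ (j (i.1.1 t))) i.1.2 < 0
  -- the boundary is the compact zero set of `ρ`
  have hBc : IsCompact ((𝓡∂ 5).boundary X) := by
    have hcl : IsClosed {x : X | ρ x ≤ 0} := isClosed_le hρs.continuous continuous_const
    have heq : (𝓡∂ 5).boundary X = {x : X | ρ x ≤ 0} := by
      ext x
      simp only [mem_setOf_eq]
      constructor
      · intro hx; exact le_of_eq ((hρb x).2 hx)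
      · intro hx; exact (hρb x).1 (le_antisymm hx (hρ0 x))
    rw [heq]
    exact hcl.isCompact
  -- local thresholds from stub 1 at every boundary point
  have hloc : ∀ z ∈ (𝓡∂ 5).boundary X, ∃ V : Set X, IsOpen V ∧ z ∈ V ∧ ∃ κ : ℝ, 0 < κ ∧
      ∀ i : ι, j (pt i) ∈ V → ρ (j (pt i)) < κ → Q i := by
    intro z hz
    obtain ⟨ν, hν1, hν2⟩ := hν z hz
    obtain ⟨V, hVo, hzV, κ, hκ, hV⟩ := h₁ N g X j ρ gb hj hjr hρs hρ0 hρb hconf z ν hν1 hν2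
    refine ⟨V, hVo, hzV, κ, hκ, fun i hiV hiκ ↦ ?_⟩
    exact hV i.1.1 i.2.1 i.1.2 hiV i.2.2.1 hiκ i.2.2.2
  obtain ⟨ε₀, hε₀, hall⟩ := h₂ j ρ hρs.continuous hρ0 hBc (fun x hx ↦ (hρb x).1 hx) pt Q hloc
  refine ⟨ε₀, hε₀, fun γ hγ t₀ hunit hlt htan ↦ ?_⟩
  exact hall ⟨(γ, t₀), hγ, hunit, htan⟩ hlt

/-- The composition applied to the two stubs: the piece, conditionally on them. -/
theorem compactificationConvexNearInfinity_conditional : CompactificationConvexNearInfinity :=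
  CompactificationConvexNearInfinity_of
    (fun N _ _ _ _ _ g _ X _ _ _ _ _ _ j ρ gb hj hjr hρ hρ0 hρb hconf z ν hν1 hν2 ↦
      stub_convexity_near_point_C2 N g X j ρ gb hj hjr hρ hρ0 hρb hconf z ν hν1 hν2)
    (fun j ρ hρc hρ0 _ hBc hρB _ pt Q hloc ↦ stub_threshold_of_local j ρ hρc hρ0 hBc hρB pt Q hloc)

end Summit.SmoothPoincare4.SmoothPoincare4.Cruxes.EinsteinHadamardFillingStandard.GgsuC2Redirect

end
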